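import Mathlib
import Literature.RingTheory.CohomologyAnnihilator.SyzygyBasic
import Summits.ResolutionOfSingularities.ResolutionOfSingularities.Theorems.HomologicalConductorNoZenoStableAnnihilatorReduction
import HarnessLib

/-!
# Crux `Persistence` (stmt-ResolutionOfSingularities-16484), chain W4.4b — the CONDUCTOR STABLY ANNIHILATES:
# `C ↪ D`, `D` a principal ideal domain, `c·D ⊆ C` ⇒ `c ∈ ca²(C)`

Route `ResolutionOfSingularities/HomologicalConductor`, chain W4.4b (cell `res-hironaka`), crux `Persistence`
(stmt-ResolutionOfSingularities-16484), KILL CANDIDATE K-C3, item K2-LOWER made UNCONDITIONAL (res-L1-w44b-stub-2 gen 4),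
part 2/4: the curve-level input «conductor ⊆ cohomology annihilator» (the half of [Esentepe2020, Thm 4.4] / Wang's
theorem that the kill uses), in an elementary GLOBAL form with no maximal Cohen–Macaulay modules, no normalisation
theory and no Nakayama.  `[OURS · L1 w44b]`; NOT a statement of the manuscript under review (Hironaka 2017), no
statement of that manuscript is used; AI-written, weaker than expert review.

## Statement (`mem_cohomologyAnnihilatorOfDegree_two_of_conductor`)

Let `C → D` be an INJECTIVE ring map (an algebra `[Algebra C D]`), `D` a principal ideal domain, and `c ∈ C` an
element «of the conductor»: `c·d ∈ C` for every `d ∈ D` (`∀ d, ∃ c', algebraMap c' = algebraMap c * d`).  Then `c`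
STABLY ANNIHILATES every `C`-module `M` that embeds `C`-linearly in some `Dⁿ` (`stablyAnnihilates_of_injective`); in
particular every first syzygy module (a submodule of a finitely generated projective, itself a summand of `Cʳ ↪ Dʳ`),
so for `C` noetherian **`c ∈ ca²(C)`** (CA1, `mem_cohomologyAnnihilatorOfDegree_succ_iff_forall_isSyzygy`).

PROOF.  Let `j : M ↪ Dⁿ`, `L = span_D j(M)`; `L` is free (`D` a PID, `Submodule.basisOfPid`) with a finite basis
`b₁,…,bₘ`, and each `bᵢ = Σ_{m'} gᵢ(m')·j(m')` is a finite `D`-combination of elements of `j(M)`.  For `m ∈ M` write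
`j(m) = Σᵢ κᵢ(m) bᵢ` (`κᵢ` is `C`-linear).  Then `c·j(m) = Σᵢ Σ_{m'} (c κᵢ(m) gᵢ(m'))·j(m')` and every coefficient
`c κᵢ(m) gᵢ(m')` lies in `C` (conductor!), say `= ρ(κᵢ(m) gᵢ(m'))` with `ρ : D → C`, `ρ(d) = c·d`, `C`-linear.  Hence
`c • 𝟙_M = β ∘ α` with `α : M → C^{m × S}`, `α(m)_{(i,m')} = ρ(κᵢ(m) gᵢ(m'))`, and `β : C^{m × S} → M`,
`e_{(i,m')} ↦ m'` (`S` a finite set of elements of `M` containing all supports): a factorisation through a finitely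
generated free module.  (No basis of `L` inside `j(M)` is needed, so `C` need not be local.)

USE: `C = k[z,t]/(z³ + t⁴) ↪ D = k[τ]` (`z ↦ −τ⁴`, `t ↦ τ³`), `c ∈ {t², zt, z²}` (`τ⁶, −τ⁷, τ⁸`; `τ⁶·k[τ] ⊆ C`):
sibling file `…PersistenceKC3LowerCurve`.

References (mechanism only): Ö. Esentepe, J. Algebra 541 (2020) Thm 4.3–4.4 (Wang: the conductor kills `Ext¹(MCM, −)`)
[`Esentepe2020`]; S. B. Iyengar, R. Takahashi, IMRN 2016, Remark 2.13 [`IyengarTakahashi2014`].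
-/

noncomputable section

-- single-problem summit: the doubled namespace component `ResolutionOfSingularities` is forced
set_option linter.dupNamespace false

namespace Summit.ResolutionOfSingularities.ResolutionOfSingularities.Theorems.HomologicalConductor.ConductorStable

open CategoryTheory Literature.RingTheory.CohomologyAnnihilator
open Summit.ResolutionOfSingularities.ResolutionOfSingularities.Theorems.NoZeno.SandwichCluster

universe u v

variable {C : Type u} [CommRing C] {D : Type v} [CommRing D] [Algebra C D]

/-! ## The conductor retraction `ρ : D → C`, `ρ(d) = c·d` -/

/-- For `c` in the conductor of an injective `C → D` there is a `C`-linear `ρ : D → C` with `algebraMap (ρ d) = c·d`.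
[folklore] -/
theorem exists_conductorRetraction (hinj : Function.Injective (algebraMap C D)) {c : C}
    (hc : ∀ d : D, ∃ c' : C, algebraMap C D c' = algebraMap C D c * d) :
    ∃ ρ : D →ₗ[C] C, ∀ d : D, algebraMap C D (ρ d) = algebraMap C D c * d := by
  choose ρ hρ using hc
  refine ⟨{ toFun := ρ, map_add' := ?_, map_smul' := ?_ }, hρ⟩
  · intro d d'
    apply hinj
    rw [map_add, hρ, hρ, hρ, mul_add]
  · intro a d
    apply hinj
    rw [RingHom.id_apply, smul_eq_mul, map_mul, hρ, hρ, Algebra.smul_def, mul_left_comm]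

/-! ## Stable annihilation of modules embedded in `Dⁿ` -/

/-- **The conductor stably annihilates every `C`-module embedded in some `Dⁿ`** (`D` a PID, `C → D` injective,
`c·D ⊆ C`): `c • 𝟙_M` factors through a finitely generated free `C`-module.  See the module docstring for the
construction. [OURS · elementary form of Esentepe2020 Thm 4.3–4.4 (Wang)] -/
theorem stablyAnnihilates_of_injective [IsDomain D] [IsPrincipalIdealRing D]
    (hinj : Function.Injective (algebraMap C D)) {c : C}
    (hc : ∀ d : D, ∃ c' : C, algebraMap C D c' = algebraMap C D c * d)
    (M : ModuleCat.{u} C) {n : ℕ} (j : M →ₗ[C] (Fin n → D)) (hj : Function.Injective j) :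
    StablyAnnihilates C c M := by
  classical
  obtain ⟨ρ, hρ⟩ := exists_conductorRetraction hinj hc
  -- `L = span_D j(M)` is free with a finite basis
  set L : Submodule D (Fin n → D) := Submodule.span D (Set.range j) with hL
  obtain ⟨m, b⟩ := Submodule.basisOfPid (Pi.basisFun D (Fin n)) L
  have hmemL : ∀ x : M, j x ∈ L := fun x => Submodule.subset_span ⟨x, rfl⟩
  -- each basis vector is a finite `D`-combination of elements of `j(M)`
  have hb : ∀ i : Fin m, ∃ g : M →₀ D, (g.sum fun x d => d • j x) = (b i : Fin n → D) := fun i => by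
    have hi : ((b i : L) : Fin n → D) ∈ Submodule.span D (Set.range j) := (b i).2
    exact (Finsupp.mem_span_range_iff_exists_finsupp (R := D) (v := fun x : M => j x)).mp hi
  choose g hg using hb
  -- a finite set of elements of `M` containing all supports
  set S : Finset M := Finset.univ.biUnion fun i => (g i).support with hS
  have hsuppS : ∀ i, ((g i).support : Set M) ⊆ S := fun i x hx =>
    Finset.mem_biUnion.mpr ⟨i, Finset.mem_univ i, hx⟩
  -- the coordinate maps `κᵢ : M → D` (C-linear)
  let jL : M →ₗ[C] (L.restrictScalars C) := LinearMap.codRestrict (L.restrictScalars C) j hmemL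
  let κ : Fin m → (M →ₗ[C] D) := fun i =>
    ((Finsupp.lapply (α := Fin m) (M := D) (R := D) i).restrictScalars C) ∘ₗ
      (b.repr.toLinearMap.restrictScalars C) ∘ₗ jL
  have hκ : ∀ (i : Fin m) (x : M), κ i x = b.repr ⟨j x, hmemL x⟩ i := fun i x => rfl
  -- `j x = Σᵢ κᵢ(x) • bᵢ`
  have hsum : ∀ x : M, (∑ i, κ i x • (b i : Fin n → D)) = j x := fun x => by
    have h := congrArg (fun l : L => (l : Fin n → D)) (b.sum_repr ⟨j x, hmemL x⟩)
    simpa only [hκ, Submodule.coe_sum, Submodule.coe_smul] using h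
  -- the factorisation
  let ι' := Fin m × (S : Set M)
  let α : M →ₗ[C] (ι' → C) :=
    LinearMap.pi fun p : ι' => ρ ∘ₗ ((LinearMap.mulRight C (g p.1 p.2.1)).restrictScalars C ∘ₗ κ p.1)
  let β : (ι' → C) →ₗ[C] M := Fintype.linearCombination C fun p : ι' => (p.2.1 : M)
  have hαβ : ∀ x : M, β (α x) = c • x := by
    intro x
    apply hj
    have hjsmul : ∀ (a : C) (y : M), j (a • y) = algebraMap C D a • j y := fun a y => by
      rw [map_smul, algebraMap_smul]
    simp only [β, α, Fintype.linearCombination_apply, map_sum, hjsmul, LinearMap.pi_apply,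
      LinearMap.coe_comp, Function.comp_apply, LinearMap.coe_restrictScalars, LinearMap.mulRight_apply, hρ]
    -- `Σ_{(i,m')} (c κᵢ(x) gᵢ(m')) • j m' = c • Σᵢ κᵢ(x) • bᵢ`
    rw [Fintype.sum_prod_type]
    simp only [mul_smul, ← Finset.smul_sum]
    congr 1
    rw [← hsum x]
    refine Finset.sum_congr rfl fun i _ => ?_
    congr 1
    -- `Σ_{m' ∈ S} gᵢ(m') • j m' = bᵢ`
    rw [← hg i, Finsupp.sum_of_support_subset (g i) (hsuppS i) (fun y d => d • j y) (fun y _ => zero_smul _ _)]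
    exact (Finset.sum_coe_sort S (fun y => g i y • j y))
  refine ⟨ModuleCat.of C (ι' → C), inferInstance,
    (IsProjective.iff_projective (R := C) (ι' → C)).mp inferInstance, ModuleCat.ofHom α, ModuleCat.ofHom β, ?_⟩
  ext x
  simpa using hαβ x

/-- A first syzygy module embeds `C`-linearly in some `Cʳ`. [folklore] -/
theorem exists_injective_toPi_of_isSyzygy_one {X M : ModuleCat.{u} C} (hM : IsSyzygy 1 X M) :
    ∃ (r : ℕ) (f : M →ₗ[C] (Fin r → C)), Function.Injective f := by
  obtain ⟨P, hPfin, hPproj, f, g, w, hS⟩ := isSyzygy_one_iff.mp hM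
  haveI := hPfin
  haveI : Module.Projective C P := moduleProjective_of_projective P hPproj
  obtain ⟨r, π, hπ⟩ := Module.Finite.exists_fin' C P
  obtain ⟨s, hs⟩ := Module.projective_lifting_property π LinearMap.id hπ
  have hsinj : Function.Injective s := fun p q hpq => by
    have := congrArg π hpq
    rwa [← LinearMap.comp_apply, ← LinearMap.comp_apply, hs] at this
  exact ⟨r, s ∘ₗ f.hom, hsinj.comp hS.moduleCat_injective_f⟩

/-- A first syzygy module over `C` embeds `C`-linearly in some `Dʳ` when `C → D` is injective. [folklore] -/
theorem exists_injective_toPi_algebra_of_isSyzygy_one (hinj : Function.Injective (algebraMap C D))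
    {X M : ModuleCat.{u} C} (hM : IsSyzygy 1 X M) :
    ∃ (r : ℕ) (f : M →ₗ[C] (Fin r → D)), Function.Injective f := by
  obtain ⟨r, f, hf⟩ := exists_injective_toPi_of_isSyzygy_one hM
  have hinj' : Function.Injective ((Algebra.linearMap C D).compLeft (Fin r)) := fun v w hvw =>
    funext fun i => hinj (by simpa [LinearMap.compLeft_apply] using congrFun hvw i)
  exact ⟨r, ((Algebra.linearMap C D).compLeft (Fin r)) ∘ₗ f, hinj'.comp hf⟩

/-- **The conductor lies in `ca²`.**  `C` noetherian, `C → D` injective into a principal ideal domain, `c ∈ C` with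
`c·D ⊆ C`: then `c ∈ ca²(C)` — `c` stably annihilates every first syzygy module (CA1).
[OURS · elementary form of Esentepe2020 Thm 4.4 «𝔠 ⊆ ca» for curve-like pairs `C ⊆ D`] -/
theorem mem_cohomologyAnnihilatorOfDegree_two_of_conductor [IsNoetherianRing C] [IsDomain D]
    [IsPrincipalIdealRing D] (hinj : Function.Injective (algebraMap C D)) {c : C}
    (hc : ∀ d : D, ∃ c' : C, algebraMap C D c' = algebraMap C D c * d) :
    c ∈ cohomologyAnnihilatorOfDegree C 2 := by
  rw [mem_cohomologyAnnihilatorOfDegree_succ_iff_forall_isSyzygy]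
  intro X M _ hM
  obtain ⟨r, f, hf⟩ := exists_injective_toPi_algebra_of_isSyzygy_one hinj hM
  exact stablyAnnihilates_of_injective hinj hc M f hf

/-- `ca`-form. [OURS] -/
theorem mem_cohomologyAnnihilator_of_conductor [IsNoetherianRing C] [IsDomain D] [IsPrincipalIdealRing D]
    (hinj : Function.Injective (algebraMap C D)) {c : C}
    (hc : ∀ d : D, ∃ c' : C, algebraMap C D c' = algebraMap C D c * d) :
    c ∈ cohomologyAnnihilator C :=
  cohomologyAnnihilatorOfDegree_le 2 (mem_cohomologyAnnihilatorOfDegree_two_of_conductor hinj hc)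

/-- RING-HOM form (no `Algebra` instance): for an injective ring map `φ : C →+* D` into a principal ideal domain and
`c ∈ C` with `φ(c)·D ⊆ φ(C)`, `c ∈ ca²(C)`. [OURS] -/
theorem mem_cohomologyAnnihilatorOfDegree_two_of_conductor_ringHom {C : Type u} [CommRing C] [IsNoetherianRing C]
    {D : Type v} [CommRing D] [IsDomain D] [IsPrincipalIdealRing D] (φ : C →+* D) (hinj : Function.Injective φ)
    {c : C} (hc : ∀ d : D, ∃ c' : C, φ c' = φ c * d) :
    c ∈ cohomologyAnnihilatorOfDegree C 2 := by
  letI : Algebra C D := φ.toAlgebra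
  exact mem_cohomologyAnnihilatorOfDegree_two_of_conductor (D := D) hinj hc

/-! ## Generalisation (rev 2): the `D`-span of `j(M)` finitely generated PROJECTIVE suffices
(multi-branch curves: `C ↪ D = ∏ᵢ Dᵢ`, `Dᵢ` principal ideal domains — `D` is then not a domain) -/

/-- **The conductor stably annihilates every `C`-module embedded in some `Dⁿ`, projective version**: `C → D` injective,
`c·D ⊆ C`, `j : M ↪ Dⁿ` `C`-linear with `L = span_D j(M)` finitely generated and PROJECTIVE over `D` (instead of `D` a
PID).  A projective coordinate system `x = Σᵢ κᵢ(x)·bᵢ` of `L` (from a `D`-linear section of `Dᵐ ↠ L`) replaces the basis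
of the PID case; the rest of the construction is unchanged. [OURS · elementary form of Esentepe2020 Thm 4.3–4.4 (Wang)] -/
theorem stablyAnnihilates_of_injective_of_projective (hinj : Function.Injective (algebraMap C D)) {c : C}
    (hc : ∀ d : D, ∃ c' : C, algebraMap C D c' = algebraMap C D c * d)
    (M : ModuleCat.{u} C) {n : ℕ} (j : M →ₗ[C] (Fin n → D)) (hj : Function.Injective j)
    (hfg : (Submodule.span D (Set.range j)).FG)
    (hproj : Module.Projective D (Submodule.span D (Set.range j))) :
    StablyAnnihilates C c M := by
  classical
  obtain ⟨ρ, hρ⟩ := exists_conductorRetraction hinj hc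
  set L : Submodule D (Fin n → D) := Submodule.span D (Set.range j) with hL
  haveI : Module.Finite D L := Module.Finite.iff_fg.mpr hfg
  haveI : Module.Projective D L := hproj
  have hmemL : ∀ x : M, j x ∈ L := fun x => Submodule.subset_span ⟨x, rfl⟩
  -- a projective coordinate system of `L`
  obtain ⟨m, π, hπ⟩ := Module.Finite.exists_fin' D L
  obtain ⟨s, hs⟩ := Module.projective_lifting_property π LinearMap.id hπ
  let b : Fin m → L := fun i => π (fun j => if i = j then (1 : D) else 0)
  have hsum0 : ∀ x : L, (∑ i, (s x) i • b i) = x := fun x => by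
    have h1 : π (s x) = x := by
      rw [← LinearMap.comp_apply, hs, LinearMap.id_apply]
    conv_rhs => rw [← h1, pi_eq_sum_univ (s x)]
    simp only [map_sum, map_smul, b]
  -- each `bᵢ` is a finite `D`-combination of elements of `j(M)`
  have hb : ∀ i : Fin m, ∃ g : M →₀ D, (g.sum fun x d => d • j x) = (b i : Fin n → D) := fun i => by
    have hi : ((b i : L) : Fin n → D) ∈ Submodule.span D (Set.range j) := (b i).2
    exact (Finsupp.mem_span_range_iff_exists_finsupp (R := D) (v := fun x : M => j x)).mp hi
  choose g hg using hb
  set S : Finset M := Finset.univ.biUnion fun i => (g i).support with hS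
  have hsuppS : ∀ i, ((g i).support : Set M) ⊆ S := fun i x hx =>
    Finset.mem_biUnion.mpr ⟨i, Finset.mem_univ i, hx⟩
  -- the coordinate maps `κᵢ : M → D` (C-linear)
  let jL : M →ₗ[C] (L.restrictScalars C) := LinearMap.codRestrict (L.restrictScalars C) j hmemL
  let κ : Fin m → (M →ₗ[C] D) := fun i =>
    ((LinearMap.proj (R := D) (φ := fun _ : Fin m => D) i).restrictScalars C) ∘ₗ (s.restrictScalars C) ∘ₗ jL
  have hκ : ∀ (i : Fin m) (x : M), κ i x = s ⟨j x, hmemL x⟩ i := fun i x => rfl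
  have hsum : ∀ x : M, (∑ i, κ i x • (b i : Fin n → D)) = j x := fun x => by
    have h := congrArg (fun l : L => (l : Fin n → D)) (hsum0 ⟨j x, hmemL x⟩)
    simpa only [hκ, Submodule.coe_sum, Submodule.coe_smul] using h
  -- the factorisation
  let ι' := Fin m × (S : Set M)
  let α : M →ₗ[C] (ι' → C) :=
    LinearMap.pi fun p : ι' => ρ ∘ₗ ((LinearMap.mulRight C (g p.1 p.2.1)).restrictScalars C ∘ₗ κ p.1)
  let β : (ι' → C) →ₗ[C] M := Fintype.linearCombination C fun p : ι' => (p.2.1 : M)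
  have hαβ : ∀ x : M, β (α x) = c • x := by
    intro x
    apply hj
    have hjsmul : ∀ (a : C) (y : M), j (a • y) = algebraMap C D a • j y := fun a y => by
      rw [map_smul, algebraMap_smul]
    simp only [β, α, Fintype.linearCombination_apply, map_sum, hjsmul, LinearMap.pi_apply,
      LinearMap.coe_comp, Function.comp_apply, LinearMap.coe_restrictScalars, LinearMap.mulRight_apply, hρ]
    rw [Fintype.sum_prod_type]
    simp only [mul_smul, ← Finset.smul_sum]
    congr 1
    rw [← hsum x]
    refine Finset.sum_congr rfl fun i _ => ?_
    congr 1
    rw [← hg i, Finsupp.sum_of_support_subset (g i) (hsuppS i) (fun y d => d • j y) (fun y _ => zero_smul _ _)]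
    exact (Finset.sum_coe_sort S (fun y => g i y • j y))
  refine ⟨ModuleCat.of C (ι' → C), inferInstance,
    (IsProjective.iff_projective (R := C) (ι' → C)).mp inferInstance, ModuleCat.ofHom α, ModuleCat.ofHom β, ?_⟩
  ext x
  simpa using hαβ x

/-- **The conductor lies in `ca²`, hereditary version.**  `C` noetherian, `C → D` injective with `D` noetherian and
HEREDITARY in the sense needed (`hD`: every submodule of every `Dⁿ` is projective — e.g. `D` a finite product of
principal ideal domains, the normalisation of a multi-branch curve), `c ∈ C` with `c·D ⊆ C`: then `c ∈ ca²(C)`.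
[OURS · elementary form of Esentepe2020 Thm 4.4 «𝔠 ⊆ ca» for curve-like pairs `C ⊆ D`] -/
theorem mem_cohomologyAnnihilatorOfDegree_two_of_conductor_of_projective [IsNoetherianRing C] [IsNoetherianRing D]
    (hD : ∀ (n : ℕ) (N : Submodule D (Fin n → D)), Module.Projective D N)
    (hinj : Function.Injective (algebraMap C D)) {c : C}
    (hc : ∀ d : D, ∃ c' : C, algebraMap C D c' = algebraMap C D c * d) :
    c ∈ cohomologyAnnihilatorOfDegree C 2 := by
  rw [mem_cohomologyAnnihilatorOfDegree_succ_iff_forall_isSyzygy]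
  intro X M _ hM
  obtain ⟨r, f, hf⟩ := exists_injective_toPi_algebra_of_isSyzygy_one hinj hM
  exact stablyAnnihilates_of_injective_of_projective hinj hc M f hf (IsNoetherian.noetherian _) (hD r _)

/-- RING-HOM form of the hereditary version. [OURS] -/
theorem mem_cohomologyAnnihilatorOfDegree_two_of_conductor_ringHom_of_projective {C : Type u} [CommRing C]
    [IsNoetherianRing C] {D : Type v} [CommRing D] [IsNoetherianRing D]
    (hD : ∀ (n : ℕ) (N : Submodule D (Fin n → D)), Module.Projective D N) (φ : C →+* D)
    (hinj : Function.Injective φ) {c : C} (hc : ∀ d : D, ∃ c' : C, φ c' = φ c * d) :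
    c ∈ cohomologyAnnihilatorOfDegree C 2 := by
  letI : Algebra C D := φ.toAlgebra
  exact mem_cohomologyAnnihilatorOfDegree_two_of_conductor_of_projective (D := D) hD hinj hc

/-- Over a principal ideal domain every submodule of `Dⁿ` is projective (free, `Submodule.basisOfPid`) — the hypothesis
`hD` of the hereditary version in the one-branch case. [folklore] -/
theorem projective_submodule_pi_of_isPrincipalIdealRing [IsDomain D] [IsPrincipalIdealRing D] (n : ℕ)
    (N : Submodule D (Fin n → D)) : Module.Projective D N := by
  obtain ⟨m, b⟩ := Submodule.basisOfPid (Pi.basisFun D (Fin n)) N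
  exact Module.Projective.of_basis b

end Summit.ResolutionOfSingularities.ResolutionOfSingularities.Theorems.HomologicalConductor.ConductorStable

end
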